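import Literature.Analysis.FluidPDE.ChaeWolfRemovingDSSBounds
import Literature.Analysis.FluidPDE.ChaeWolfRemovingDSSProofs
import Literature.Analysis.FluidPDE.PineauVicolOneSliceRegularityHolds
import HarnessLib

/-!
# Barrier: no Type I `λ`-DSS blow-up profile at fine scale ratio `λ ↓ 1`
(Chae–Wolf 2017, Thm. 1.3; Pineau–Vicol 2026, Thms. 1.6, 1.9)

Barrier catalogue entry for `NavierStokesRegularity` (D-0021), on the NEGATIVE side (routes aiming
at `¬ NavierStokesRegularity` through a Type I blow-up whose profile is, or is modelled on, a
backward *discretely* self-similar (`λ`-DSS) solution with scaling factor `λ` close to `1`). The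
two printed theorems are already vendored AND DISCHARGED in the tree:

* `Literature.Analysis.FluidPDE.chaeWolf2017_removing_dss` (Chae–Wolf 2017, Thm. 1.3; file
  `Literature/Analysis/FluidPDE/ChaeWolfRemovingDSS.lean`), proved as
  `Literature.Analysis.FluidPDE.chaeWolf2017_removing_dss_holds`
  (`ChaeWolfRemovingDSSProofs.lean`, following the printed §3 and ending in Tsai 1998, Thm. 1);
* `Literature.Analysis.FluidPDE.pineauVicol2026_oneSlice_regularity` (Pineau–Vicol 2026,
  Thm. 1.9; file `PineauVicolOneSlice.lean`), proved as
  `Literature.Analysis.FluidPDE.pineauVicol2026_oneSlice_regularity_holds`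
  (`PineauVicolOneSliceRegularityHolds.lean`).

This file records their conjunction `NearOneDssTypeIExclusion` under
`Literature/Barriers/NavierStokesRegularity/` with the structured barrier docstring that the gate
indexes, proves it (`NearOneDssTypeIExclusion_holds`), and proves the reformulations that face the
technique class: non-existence of nontrivial fine-ratio profiles, the ratio lower bound
`λ ≥ λ₁(C₀)` for nontrivial profiles, the "eventually in `λ → 1⁺`" (overheating) form, the
sequence form `λₙ → 1`, and the small-constant end of the excluded region (Chae–Wolf 2017,
Remark 1.4, here from the tree's `ChaeWolf.exists_eps_typeI_small_eq_zero`). Nothing new is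
assumed: no named fact is introduced, the barrier is a theorem of the tree.

## What is printed

* D. Chae, J. Wolf, *Removing discretely self-similar singularities for the 3D Navier–Stokes
  equations*, Comm. PDE 42 (2017) 1359–1374 = arXiv:1610.09464 (held: paper:arxiv-1610.09464).
  §1 p. 2: `u : ℝ³ × (−∞,0) → ℝ³` is backward `λ`-DSS, `λ ∈ (1, ∞)`, if
  `u(x,t) = λu(λx, λ²t)` (1.2); "For the case of Navier–Stokes equations such nonexistence result
  for the nontrivial discretely self-similar solutions is still not available in the literature."
  **Theorem 1.3** (p. 3, verbatim): "For
  every `C_* > 0` there exists `λ_* > 1` depending on `C_*` such that if `u ∈ C^∞(Q)` is a `λ`-DSS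
  solution [to] the Navier–Stokes equations for `λ ∈ (1, λ_*)`, which satisfies
  `|u(x,t)| ≤ C_*/(√(−t) + |x|)` `∀ (x,t) ∈ Q` (1.7), then `u ≡ 0`." **Remark 1.4**: "the criterion
  of [Gustafson–Kang–Tsai] implies that if `C_*` in (1.7) is small enough, then every `λ`-DSS
  solution … satisfying (1.7) is trivial." **Theorem 1.1**: `λ`-DSS solutions in
  `C((−∞,0); Lᵖ) ∩ C^∞(Q)`, `3 ≤ p < ∞`, are regular off the origin and obey (1.7) for some `C`.
  **Theorem 1.5**: asymptotically `λ`-DSS singularities (in the sense (1.8)) with `λ ∈ (1, λ_*)`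
  are regular points. Proof of Thm. 1.3 (§3, pp. 8–9): Step 1, a nontrivial `λ`-DSS solution has
  `∫_{Q(0,1)} |u|³ > ε³`; Step 2, "Indirect argument": nontrivial `λⱼ`-DSS solutions with
  `λⱼ → 1` and the common bound (1.7) converge (a priori bounds (3.6)–(3.7), Aubin–Lions,
  Arzelà–Ascoli) to a nontrivial local suitable solution which is backward SELF-SIMILAR
  (`μ²ω(μx, μ²t) = ω(x,t)` for every `μ > 1`), excluded by Tsai's theorem.
* B. Pineau, V. Vicol, *On rotated backwards self-similar solutions of the incompressible 3D
  Navier–Stokes equations*, arXiv:2607.09619 (2026) (held: paper:arxiv-2607.09619). §1.3 p. 5: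
  `λ`-DSS blow-up = periodic profile `U(y,s)`, `s = −log(−t)`, period `S = 2 log λ` (1.11);
  "as `λ → 1⁺` the profile `U` formally becomes time-independent since `S → 0⁺`"; footnote 8: a
  `λ`-DSS field is `λᵏ`-DSS for all `k ∈ ℕ`, the factor meant being the smallest one. P. 6:
  "Not much seems to be known about the existence of solutions to (1.12), other than the
  … theorem of Chae and Wolf … obtained by a compactness argument … The advantage of the proof we
  present … is that it is quantitative and provides an explicit a-priori bound for the
  vorticity"; **Theorem 1.6** re-states Chae–Wolf's theorem (`U ∈ C²`, Type I bound (1.10) on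
  `ℝ³ × [−1,0)`, `1 < λ < λ_(C_{U,0})` forces `U ≡ 0`). P. 7, after Thm. 1.7: the proof is "an
  extension of the proof of Theorem 1.4, with the additional knowledge that `∂ₛU` is not zero, but
  is instead small in a suitable sense, if the period `S` is assumed small (equivalently, if `λ` is
  close to `1`)"; Lemma 7.2 (p. 24): the fluctuation `U − ⟨U⟩ₛ` is `O(S)`. §1.5 p. 8,
  **Theorem 1.9** (local criterion, no self-similarity assumed): a smooth solution on
  `B₁ × [−1,0)` with the Type I bound (1.15), pressure bounded on the annulus
  `{1/2 < |x| < 3/4}` (1.16), and `‖√(−t̄)((−t̄)∂ₜu − ½u − ½(x·∇)u)(·,t̄)‖_{L^∞(B₁)} ≤ δ₀(C_u)` at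
  ONE time `t̄ ∈ (−e^{−s₀}, 0)` (1.17) is regular at `(0,0)`; Remark 1.10: (1.17) is
  `‖∂ₛU(·,s̄)‖_{L^∞} ≤ δ₀`, the deviation from backward self-similarity on one slice.
* Z. Bradshaw, T.-P. Tsai, Comm. PDE 42 (2017) = arXiv:1610.05680, Appendix §5, question 5.1
  (p. 14): whether backward RSS/DSS/RDSS solutions with `|v| ≤ C/(|x| + √(−t))` remain bounded up
  to `t = 0` is unsettled (in the tree: the wall `Literature.Analysis.FluidPDE.TypeIDSSLiouville λ`,
  an unproved `def … : Prop` for every single `λ`).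

## Rendering and formal status

`NearOneDssTypeIExclusion` is the conjunction of the two in-tree named facts, both theorems of
the tree, so the barrier is discharged here (`NearOneDssTypeIExclusion_holds`; trust base:
Mathlib's axioms). The conjuncts are NOT formally linked: the printed heuristic "`λ` near `1` ⇒
`∂ₛU` small ⇒ one-slice criterion" (Pineau–Vicol, p. 7 and Lemma 7.2) is not formalised, and the
local theorem is recorded as the companion covering Type I envelopes given only in a parabolic
cylinder. The reformulations below are proved from the first conjunct; the small-constant end
(`ancient_typeI_smallConstant_eq_zero`) is the tree's substitute for Remark 1.4 (mildness of
Type I classical solutions and the Oseen-kernel bound instead of the Gustafson–Kang–Tsai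
criterion), valid for every solution, DSS or not.

Consumers: route NavierStokesRegularity/PumpContinuation (wanted_by; crux `EulerProximatePump`:
continuation of a fine-ratio pump seed towards the Euler form at bounded Type I constant), the
target normal form `Cruxes/Target/Disproof.lean` §4 `target_dss_near_one`, and every route whose
blow-up profile is `λ`-DSS with `λ` an integer power of `1 + ε₀`, `ε₀` small, as in Tao's cascade
scales (Tao 2016, §3 Def. 3.1, Thm. 3.2; §4: "`λ = (1+ε₀)^{5/2}`").

## References

* D. Chae, J. Wolf, Comm. PDE 42 (2017) 1359–1374 = arXiv:1610.09464: §1 (p. 2), Thms. 1.1, 1.3,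
  Remark 1.4, Thm. 1.5 (pp. 3–4), §3 Steps 1–2 (pp. 8–9). [`ChaeWolf2017RemovingDSS`]
* B. Pineau, V. Vicol, arXiv:2607.09619 (2026): §1.3 (pp. 5–6), Thm. 1.6 (p. 6), Thm. 1.7 and the
  paragraph after it (p. 7), §1.5 Thm. 1.9, Remarks 1.10–1.11, footnote 12 (p. 8), Lemma 7.2
  (p. 24), §9. [`PineauVicol2026`]
* Z. Bradshaw, T.-P. Tsai, Comm. PDE 42 (2017) 1065–1087 = arXiv:1610.05680, Appendix §5,
  question 5.1 (p. 14). [`BradshawTsai2017CPDE`]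
* T.-P. Tsai, Arch. Rational Mech. Anal. 143 (1998), Thms. 1–2. [`Tsai1998`]
* S. Gustafson, K. Kang, T.-P. Tsai, Comm. Math. Phys. 273 (2007). [`GustafsonKangTsai2007`]
* Z. Bradshaw, T.-P. Tsai, Analysis & PDE 12 (2019), Thm. 1.2; D. Chae, J. Wolf, Ann. Inst.
  H. Poincaré C 35 (2018), Thm. 1.4 (forward DSS solutions exist for every `λ > 1`).
  [`BradshawTsai2019`, `ChaeWolf2018`]
* T. Tao, J. Amer. Math. Soc. 29 (2016) = arXiv:1402.0290, §3 Def. 3.1, Thm. 3.2, §4.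
  [`Tao2016AveragedNS`]
-/

noncomputable section

open Set Filter

namespace Literature.Barriers.NavierStokesRegularity

/-- Local notation for physical space `ℝ³ = EuclideanSpace ℝ (Fin 3)`. -/
local notation "ℝ³" => EuclideanSpace ℝ (Fin 3)

/-- **Barrier (Chae–Wolf 2017, Thm. 1.3 = Pineau–Vicol 2026, Thm. 1.6; Pineau–Vicol 2026,
Thm. 1.9): no Type I `λ`-DSS blow-up profile at fine scale ratio.** Conjunction of two theorems
of the tree. (i) For every Type I constant `C₀ > 0` there is `λ₁ = λ₁(C₀) > 1` such that every
classical solution `(u, p)` of Navier–Stokes (`ν = 1`, no force) on `ℝ³ × (−∞, 0)` which is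
`λ`-discretely self-similar, `λu(λ²t, λx) = u(t,x)`, with `1 < λ < λ₁`, and obeys
`‖u(t,x)‖ ≤ C₀/(‖x‖ + √(−t))`, vanishes identically — so no ancient `λ`-DSS Type I profile with
constant `C₀` and ratio below `λ₁(C₀)` is singular, indeed nonzero
[cite: ChaeWolf2017RemovingDSS, Theorem 1.3 (arXiv:1610.09464 p. 3)]
(`Literature.Analysis.FluidPDE.chaeWolf2017_removing_dss`). (ii) The local companion with no
self-similarity assumed: for every `C_u > 0` there is `δ₀ ∈ (0,1]`, and for every `C_p > 0` an
`s₀ ≥ 1`, such that a classical solution on `[−1,0) × B₁` with `‖u‖ ≤ C_u/(√(−t) + ‖x‖)` there,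
`|p| ≤ C_p` on `[−1,0) × {1/2 < ‖x‖ < 3/4}`, and
`‖√(−t̄)((−t̄)∂ₜu − ½u − ½(x·∇)u)(t̄, ·)‖ ≤ δ₀` on `B₁` at ONE time `t̄ ∈ (−e^{−s₀}, 0)`, is bounded
on `B_r × (−r², 0)` for some `r > 0` [cite: PineauVicol2026, Theorem 1.9 (arXiv:2607.09619 p. 8)]
(`Literature.Analysis.FluidPDE.pineauVicol2026_oneSlice_regularity`).

BARRIER (structured block, D-0021):
technique_class: dss-blowup-profile-fine-scale-ratio type-I-discretely-self-similar-ancient-solution near-one-scaling-factor-lambda cascade-pump-seed-ratio-one-plus-epsilon operator-homotopy-endpoint-type-I-dss one-slice-approximately-self-similar-type-I blowup-construction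
blocks: the negation ¬NavierStokesRegularity via a Type I singularity whose blow-up profile is an ancient smooth `λ`-DSS solution `u(x,t) = λu(λx, λ²t)` on `ℝ³ × (−∞,0)` with `|u| ≤ C_*/(√(−t) + |x|)` and scaling factor in the fine range `1 < λ < λ_*(C_*)` — every such solution is `u ≡ 0` [cite: ChaeWolf2017RemovingDSS, Theorem 1.3 (arXiv:1610.09464 p. 3)] [cite: PineauVicol2026, Theorem 1.6 (arXiv:2607.09619 p. 6)]; hence along any family of such profiles with a COMMON Type I constant and ratios `λₙ → 1⁺` (e.g. profiles inheriting the scale ratio `1 + ε₀`, `ε₀` small, of a cascade construction [cite: Tao2016AveragedNS, §3 Definition 3.1 and Theorem 3.2]) all but finitely many are trivial (`NearOneDssTypeIExclusion.eventually_eq_zero_of_tendsto`), equivalently a nontrivial profile at ratio `λ` has Type I constant `C₀` with `λ ≥ λ₁(C₀)`, unbounded as `λ ↓ 1` (`NearOneDssTypeIExclusion.eventually_not_hasTypeIDecay`); asymptotically `λ`-DSS singularities with `λ ∈ (1, λ_*)` in the sense of Chae–Wolf (1.8) are regular points (print-only here) [cite: ChaeWolf2017RemovingDSS, Theorem 1.5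 (arXiv:1610.09464 pp. 3–4)]; locally, a Type I solution in a parabolic cylinder that is `δ₀(C_u)`-approximately backward self-similar on ONE late time slice is regular at the vertex [cite: PineauVicol2026, Theorem 1.9 and Remark 1.10 (arXiv:2607.09619 p. 8)]; at the small-constant end every Type I ancient solution with `C_*` below an absolute threshold is trivial for ALL ratios [cite: ChaeWolf2017RemovingDSS, Remark 1.4 (arXiv:1610.09464 p. 3)] (`ancient_typeI_smallConstant_eq_zero`).
because: (i) indirect compactness in `λ`: nontrivial `λⱼ`-DSS solutions with `λⱼ → 1` and a common Type I bound have `∫_{Q(0,1)}|uʲ|³ > ε³` (Step 1) and converge, by the a priori bounds (3.6)–(3.7), Aubin–Lions and Arzelà–Ascoli, to a nontrivial local suitable solution satisfying `μ²ω(μx,μ²t) = ω(x,t)` for EVERY `μ > 1`, i.e. a backward self-similar solution with local energy estimates, which Tsai's theorem excludes [cite: ChaeWolf2017RemovingDSS, §3 Steps 1–2 (arXiv:1610.09464 pp. 8–9)] [cite: Tsai1998, Thm. 2]; (ii) in similarity variables `λ → 1⁺` means period `S = 2 log λ → 0⁺`, the `s`-fluctuation of the profile is `O(S)`, and the weighted-`L²`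 enstrophy argument for self-similar profiles absorbs `∂ₛU` as a small error — quantitative, with an explicit a priori vorticity bound [cite: PineauVicol2026, §1.3 p. 6, paragraph after Theorem 1.7 (p. 7) and Lemma 7.2 (arXiv:2607.09619 p. 24)]; the local criterion turns one-slice smallness of `∂ₛU` into small local enstrophy, propagated to later times and fed into Caffarelli–Kohn–Nirenberg `ε`-regularity [cite: PineauVicol2026, §1.5 (arXiv:2607.09619 p. 9, first paragraph) and §9].
evasions_known: COARSE ratio — for `λ` away from `1` (relative to the Type I constant) no Liouville theorem for backward `λ`-DSS Type I solutions is known: "such nonexistence result for the nontrivial discretely self-similar solutions is still not available in the literature" [cite: ChaeWolf2017RemovingDSS, §1 (arXiv:1610.09464 p. 2)], "Not much seems to be known about the existence of solutions to (1.12), other than [Chae–Wolf]" [cite: PineauVicol2026, §1.3 (arXiv:2607.09619 p. 6)], and whether backward RSS/DSS/RDSS solutions with `|v| ≤ C/(|x|+√(−t))` remain bounded up to `t = 0` is Bradshaw–Tsai's unsettled question 5.1 [cite: BradshawTsai2017CPDE, Appendix §5, question 5.1 (arXiv:1610.05680 p. 14)] (tree: the wall `Literature.Analysis.FluidPDE.TypeIDSSLiouville`,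 not settled for any single `λ` by this barrier since `λ₁` depends on `C₀`); LARGE constant at fixed ratio — `λ_*` depends on `C_*` and nothing is asserted when `C_*` grows with `λ` fixed [cite: ChaeWolf2017RemovingDSS, Theorem 1.3 (arXiv:1610.09464 p. 3)]; NON-MINIMAL factor — a `λ`-DSS field is `λᵏ`-DSS for every `k ∈ ℕ` and the theorems bite on the factor actually assumed, so a profile whose minimal factor `λᵏ ≥ λ_*` is merely a multiple period of a fine ratio is not covered [cite: PineauVicol2026, §1.3 footnote 8 (arXiv:2607.09619 p. 5)]; ROTATED DSS with `λ` near `1` is excluded only for `|α| ≤ α_` or `|α| ≥ ᾱ` (then `1 < λ < λ̄^{1/(1+α²)}`), `α ≈ 1` not covered [cite: PineauVicol2026, Theorem 1.7 (arXiv:2607.09619 p. 7) and the sentence after Theorem 1.4 (p. 4)]; Type II or non-self-similar-type singularities are untouched, only ASYMPTOTICALLY `λ`-DSS ones with `λ` near `1` being excluded [cite: ChaeWolf2017RemovingDSS, Theorem 1.5 (arXiv:1610.09464 pp. 3–4)]; FORWARD `λ`-DSS solutions exist for every `λ > 1` and every `λ`-DSS datum in `L²_loc` and are not blow-up profiles [cite: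 BradshawTsai2019, Thm 1.2] [cite: ChaeWolf2018, Thm 1.4].
scope_caveats: (a) FORMAL scope of conjunct (i): classical solutions `(u, p)` jointly `C^∞` on `(−∞,0) × ℝ³` with an explicit pressure, `ν = 1`, the DSS relation `λu(λ²t,λx) = u(t,x)` at all times and the Type I bound on ALL of `ℝ³ × (−∞,0)` — GLOBAL ancient profiles; a finite-energy blow-up enters only through its tangent flow, and "Type I singularity ⇒ `λ`-DSS ancient profile" is a HYPOTHESIS of the scenario, not a conclusion of any theorem here [cite: ChaeWolf2017RemovingDSS, Theorem 1.3 (arXiv:1610.09464 p. 3)]; (b) the thresholds are existential: `λ_*(C_*)` comes from an indirect compactness argument with no size information [cite: ChaeWolf2017RemovingDSS, §3 Step 2 (arXiv:1610.09464 p. 8)], Pineau–Vicol's re-proof is quantitative in its a priori bounds but prints no closed-form `λ_(C_{U,0})` [cite: PineauVicol2026, §1.3 p. 6 and §7 (arXiv:2607.09619 pp. 23–29)], and the tree's `c₁` in `chaeWolf2017_removing_dss` is a bare existential — so the barrier gives NO numerical test at a prescribed ratio such as `(1+ε₀)^{5/2}`, `3/2` or `2`, and for a fixed `λ > 1` it yields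 no constant threshold beyond the absolute small-constant one of `ancient_typeI_smallConstant_eq_zero`; (c) FORMAL scope of conjunct (ii): classical solutions on the region `[−1,0) × B₁` (time derivative `timeDerivOn` within the region), Type I bound there, `|p| ≤ C_p` on `[−1,0) × {1/2 < ‖x‖ < 3/4}`, smallness (1.17) pointwise on the unit ball `‖x‖ < 1` at one `t̄ ∈ (−e^{−s₀}, 0)`, conclusion = a bound on `B_r × (−r², 0)` (the printed regular point, footnote 12), `δ₀(C_u) ∈ (0,1]`, `s₀(C_u, C_p) ≥ 1` existential [cite: PineauVicol2026, Theorem 1.9 and footnote 12 (arXiv:2607.09619 p. 8)]; the implication "`λ`-DSS with `λ` near `1` ⇒ (1.17) on some slice" is printed only as the mechanism of Thms. 1.6–1.7 (fluctuation `O(S)`) and is NOT formalised — the two conjuncts are logically independent in this file [cite: PineauVicol2026, paragraph after Theorem 1.7 (p. 7) and Lemma 7.2 (p. 24)]; (d) the Type I envelope of Thm. 1.1 (`λ`-DSS solutions in `C((−∞,0);Lᵖ)`, `3 ≤ p < ∞`, obey (1.7) for some `C`) is the separate named fact `Literature.Analysis.FluidPDE.chaeWolf2017_dss_typeI_decay`,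 proved in the tree for `3 ≤ p < 9` (`chaeWolf2017_dss_typeI_decay_of_lt_nine`) and conditional for `p ≥ 9` (`chaeWolf2017_dss_typeI_decay_holds_of`); it is not a conjunct here [cite: ChaeWolf2017RemovingDSS, Theorem 1.1 (arXiv:1610.09464 p. 3)]; (e) normalisations: `ν = 1`, singularity at the space–time origin (general `ν` and centre by scaling and translation, not formalised); conjunct (ii) is an arXiv preprint (v2, 2026, unrefereed) but a theorem of the tree [cite: PineauVicol2026, Theorem 1.9].
status: established — both conjuncts are theorems of the tree (`Literature.Analysis.FluidPDE.chaeWolf2017_removing_dss_holds`, `Literature.Analysis.FluidPDE.pineauVicol2026_oneSlice_regularity_holds`; the conjunction is `NearOneDssTypeIExclusion_holds` below) [cite: ChaeWolf2017RemovingDSS, Theorem 1.3] -/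
def NearOneDssTypeIExclusion : Prop :=
  Literature.Analysis.FluidPDE.chaeWolf2017_removing_dss ∧
    Literature.Analysis.FluidPDE.pineauVicol2026_oneSlice_regularity

section Conjuncts

open Literature.Analysis.FluidPDE

/-- Projection: the ancient, global conjunct (Chae–Wolf 2017, Thm. 1.3).
[cite: ChaeWolf2017RemovingDSS, Theorem 1.3 (arXiv:1610.09464 p. 3)] -/
theorem NearOneDssTypeIExclusion.removing (h : NearOneDssTypeIExclusion) :
    chaeWolf2017_removing_dss :=
  h.1

/-- Projection: the local one-slice conjunct (Pineau–Vicol 2026, Thm. 1.9).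
[cite: PineauVicol2026, Theorem 1.9 (arXiv:2607.09619 p. 8)] -/
theorem NearOneDssTypeIExclusion.oneSlice (h : NearOneDssTypeIExclusion) :
    pineauVicol2026_oneSlice_regularity :=
  h.2

/-- The two in-tree facts assemble the barrier. [cite: ChaeWolf2017RemovingDSS, Theorem 1.3] -/
theorem nearOneDssTypeIExclusion_of (h₁ : chaeWolf2017_removing_dss)
    (h₂ : pineauVicol2026_oneSlice_regularity) : NearOneDssTypeIExclusion :=
  ⟨h₁, h₂⟩

/-- **The barrier holds unconditionally**: both conjuncts are theorems of the tree
(`chaeWolf2017_removing_dss_holds`, Chae–Wolf 2017 Thm. 1.3 proved along the printed §3 ending in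
Tsai 1998 Thm. 1; `pineauVicol2026_oneSlice_regularity_holds`, Pineau–Vicol 2026 Thm. 1.9).
[cite: ChaeWolf2017RemovingDSS, Theorem 1.3 and §3 (arXiv:1610.09464 pp. 3, 8–9)] -/
theorem NearOneDssTypeIExclusion_holds : NearOneDssTypeIExclusion :=
  ⟨chaeWolf2017_removing_dss_holds, pineauVicol2026_oneSlice_regularity_holds⟩

/-! ### Reformulations facing the technique class (all proved from the first conjunct) -/

/-- **No nontrivial Type I `λ`-DSS ancient profile at fine ratio** (non-existence form of
Chae–Wolf 2017, Thm. 1.3): for every `C₀ > 0` there is `c₁ > 1` such that there is NO classical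
`c`-DSS solution on `ℝ³ × (−∞,0)` with `1 < c < c₁` and the Type I bound with constant `C₀` which
is nonzero somewhere — in particular none which is singular at the origin.
[cite: ChaeWolf2017RemovingDSS, Theorem 1.3 (arXiv:1610.09464 p. 3)] -/
theorem NearOneDssTypeIExclusion.no_nontrivial_fineRatio_dss (h : NearOneDssTypeIExclusion)
    {C₀ : ℝ} (hC₀ : 0 < C₀) :
    ∃ c₁ : ℝ, 1 < c₁ ∧ ¬ ∃ (c : ℝ) (u : ℝ → ℝ³ → ℝ³) (p : ℝ → ℝ³ → ℝ),
      1 < c ∧ c < c₁ ∧ IsClassicalNSSolutionOn (Iio 0) 1 0 u p ∧ IsDiscretelySelfSimilar c u ∧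
        HasTypeIDecay C₀ u ∧ ∃ t < 0, ∃ x, u t x ≠ 0 := by
  obtain ⟨c₁, hc₁, H⟩ := h.1 C₀ hC₀
  refine ⟨c₁, hc₁, ?_⟩
  rintro ⟨c, u, p, h1, h2, hsol, hdss, hI, t, ht, x, hx⟩
  exact hx (H c h1 h2 u p hsol hdss hI t ht x)

/-- **Ratio lower bound for nontrivial profiles** (contrapositive of Chae–Wolf 2017, Thm. 1.3):
for every `C₀ > 0` there is `c₁ = λ₁(C₀) > 1` such that the scaling factor of every NONTRIVIAL
classical `c`-DSS solution on `ℝ³ × (−∞,0)` with Type I constant `C₀` satisfies `c₁ ≤ c` — a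
fine-ratio DSS blow-up profile must "beat `λ₁(C₀)`".
[cite: ChaeWolf2017RemovingDSS, Theorem 1.3 (arXiv:1610.09464 p. 3)] -/
theorem NearOneDssTypeIExclusion.threshold_le_ratio (h : NearOneDssTypeIExclusion) {C₀ : ℝ}
    (hC₀ : 0 < C₀) :
    ∃ c₁ : ℝ, 1 < c₁ ∧ ∀ (c : ℝ) (u : ℝ → ℝ³ → ℝ³) (p : ℝ → ℝ³ → ℝ), 1 < c →
      IsClassicalNSSolutionOn (Iio 0) 1 0 u p → IsDiscretelySelfSimilar c u →
      HasTypeIDecay C₀ u → (∃ t < 0, ∃ x, u t x ≠ 0) → c₁ ≤ c := by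
  obtain ⟨c₁, hc₁, H⟩ := h.1 C₀ hC₀
  refine ⟨c₁, hc₁, fun c u p h1 hsol hdss hI hnt => ?_⟩
  obtain ⟨t, ht, x, hx⟩ := hnt
  by_contra hlt
  exact hx (H c h1 (lt_of_not_ge hlt) u p hsol hdss hI t ht x)

/-- **Overheating form** (Chae–Wolf 2017, Thm. 1.3 read along `λ → 1⁺`): for every Type I
constant `C₀ > 0`, for all scaling factors `c` in a right neighbourhood of `1`, NO nontrivial
classical `c`-DSS solution on `ℝ³ × (−∞,0)` obeys the Type I bound with constant `C₀` — the
minimal Type I constant of nontrivial `c`-DSS ancient profiles is unbounded as `c ↓ 1`.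
[cite: ChaeWolf2017RemovingDSS, Theorem 1.3 (arXiv:1610.09464 p. 3)] -/
theorem NearOneDssTypeIExclusion.eventually_not_hasTypeIDecay (h : NearOneDssTypeIExclusion)
    {C₀ : ℝ} (hC₀ : 0 < C₀) :
    ∀ᶠ c in nhdsWithin (1 : ℝ) (Ioi 1), ∀ (u : ℝ → ℝ³ → ℝ³) (p : ℝ → ℝ³ → ℝ),
      IsClassicalNSSolutionOn (Iio 0) 1 0 u p → IsDiscretelySelfSimilar c u →
      (∃ t < 0, ∃ x, u t x ≠ 0) → ¬ HasTypeIDecay C₀ u := by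
  obtain ⟨c₁, hc₁, H⟩ := h.1 C₀ hC₀
  filter_upwards [Ioo_mem_nhdsGT hc₁] with c hc u p hsol hdss hnt hI
  obtain ⟨t, ht, x, hx⟩ := hnt
  exact hx (H c hc.1 hc.2 u p hsol hdss hI t ht x)

/-- **Sequence form** (the technique class as stated: profiles arriving at ratios `λₙ → 1` with a
bounded Type I constant): if `(uₙ, pₙ)` are classical `cₙ`-DSS solutions on `ℝ³ × (−∞,0)` with
`cₙ > 1`, `cₙ → 1`, and a COMMON Type I constant `C₀`, then all but finitely many vanish
identically (Chae–Wolf's indirect argument, §3 Step 2, turned around).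
[cite: ChaeWolf2017RemovingDSS, Theorem 1.3 and §3 Step 2 (arXiv:1610.09464 pp. 3, 8)] -/
theorem NearOneDssTypeIExclusion.eventually_eq_zero_of_tendsto (h : NearOneDssTypeIExclusion)
    {C₀ : ℝ} (hC₀ : 0 < C₀) {c : ℕ → ℝ} (hc : ∀ n, 1 < c n)
    (hlim : Tendsto c atTop (nhds 1)) {u : ℕ → ℝ → ℝ³ → ℝ³} {p : ℕ → ℝ → ℝ³ → ℝ}
    (hsol : ∀ n, IsClassicalNSSolutionOn (Iio 0) 1 0 (u n) (p n))
    (hdss : ∀ n, IsDiscretelySelfSimilar (c n) (u n)) (hI : ∀ n, HasTypeIDecay C₀ (u n)) :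
    ∀ᶠ n in atTop, ∀ t < 0, ∀ x, u n t x = 0 := by
  obtain ⟨c₁, hc₁, H⟩ := h.1 C₀ hC₀
  filter_upwards [hlim.eventually (eventually_lt_nhds hc₁)] with n hn
  exact H (c n) (hc n) hn (u n) (p n) (hsol n) (hdss n) (hI n)

/-- A threshold for the constant `C₀` serves every family with constants BOUNDED by `C₀`
(monotonicity of the Type I bound in the constant): uniform version of the sequence form.
[cite: ChaeWolf2017RemovingDSS, Theorem 1.3 (arXiv:1610.09464 p. 3)] -/
theorem NearOneDssTypeIExclusion.eventually_eq_zero_of_tendsto_of_le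
    (h : NearOneDssTypeIExclusion) {C₀ : ℝ} (hC₀ : 0 < C₀) {c : ℕ → ℝ} (hc : ∀ n, 1 < c n)
    (hlim : Tendsto c atTop (nhds 1)) {u : ℕ → ℝ → ℝ³ → ℝ³} {p : ℕ → ℝ → ℝ³ → ℝ}
    (hsol : ∀ n, IsClassicalNSSolutionOn (Iio 0) 1 0 (u n) (p n))
    (hdss : ∀ n, IsDiscretelySelfSimilar (c n) (u n)) {C : ℕ → ℝ} (hle : ∀ n, C n ≤ C₀)
    (hI : ∀ n, HasTypeIDecay (C n) (u n)) :
    ∀ᶠ n in atTop, ∀ t < 0, ∀ x, u n t x = 0 := by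
  refine h.eventually_eq_zero_of_tendsto hC₀ hc hlim hsol hdss fun n t ht x => ?_
  refine (hI n t ht x).trans ?_
  have hden : 0 < ‖x‖ + Real.sqrt (-t) :=
    add_pos_of_nonneg_of_pos (norm_nonneg _) (Real.sqrt_pos.2 (by linarith))
  exact div_le_div_of_nonneg_right (hle n) hden.le

/-! ### The small-constant end of the excluded region (Chae–Wolf 2017, Remark 1.4) -/

/-- **Small Type I constant: trivial for every ratio, indeed for every solution** (Chae–Wolf 2017,
Remark 1.4: "if `C_*` in (1.7) is small enough, then every `λ`-DSS solution … satisfying (1.7) is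
trivial", there via the Gustafson–Kang–Tsai criterion; here the tree's substitute
`ChaeWolf.exists_eps_typeI_small_eq_zero` — mildness of Type I classical solutions and the
Oseen-kernel bound — which needs no self-similarity at all). There is an absolute `ε₀ > 0` such
that every classical solution `(u, p)` of Navier–Stokes (`ν = 1`, no force) on `ℝ³ × (−∞,0)` with
`‖u(t,x)‖ ≤ C₀/(‖x‖ + √(−t))`, `0 ≤ C₀ ≤ ε₀`, vanishes identically.
[cite: ChaeWolf2017RemovingDSS, Remark 1.4 (arXiv:1610.09464 p. 3)] -/
theorem ancient_typeI_smallConstant_eq_zero :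
    ∃ ε₀ : ℝ, 0 < ε₀ ∧ ∀ {C₀ : ℝ} {u : ℝ → ℝ³ → ℝ³} {p : ℝ → ℝ³ → ℝ}, 0 ≤ C₀ → C₀ ≤ ε₀ →
      IsClassicalNSSolutionOn (Iio 0) 1 0 u p → HasTypeIDecay C₀ u → ∀ t < 0, ∀ x, u t x = 0 := by
  obtain ⟨ε₀, hε₀, H⟩ := ChaeWolf.exists_eps_typeI_small_eq_zero
  refine ⟨ε₀, hε₀, fun {C₀ u p} hC₀ hle hsol hI => H hC₀ hsol hI fun t ht x => ?_⟩
  have hs : 0 < Real.sqrt (-t) := Real.sqrt_pos.2 (by linarith)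
  have hden : 0 < ‖x‖ + Real.sqrt (-t) := add_pos_of_nonneg_of_pos (norm_nonneg _) hs
  calc Real.sqrt (-t) * ‖u t x‖ ≤ Real.sqrt (-t) * (C₀ / (‖x‖ + Real.sqrt (-t))) :=
        mul_le_mul_of_nonneg_left (hI t ht x) hs.le
    _ ≤ C₀ := by
        rw [mul_div_assoc', div_le_iff₀ hden]
        nlinarith [norm_nonneg x]
    _ ≤ ε₀ := hle

/-- **The excluded region of the (constant, ratio) plane.** There is an absolute `ε₀ > 0`, and
for every `C₀ > 0` a `c₁ = λ₁(C₀) > 1`, such that a classical `c`-DSS solution on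
`ℝ³ × (−∞,0)` with Type I constant `C₀` vanishes whenever `C₀ ≤ ε₀` (any `c`) or `c < c₁`: the
union of the small-constant strip (Remark 1.4) and the fine-ratio region (Thm. 1.3). What lies
outside — coarse ratio at large constant — is Bradshaw–Tsai's unsettled question 5.1.
[cite: ChaeWolf2017RemovingDSS, Theorem 1.3 and Remark 1.4 (arXiv:1610.09464 p. 3)] -/
theorem NearOneDssTypeIExclusion.eq_zero_of_smallConstant_or_fineRatio
    (h : NearOneDssTypeIExclusion) :
    ∃ ε₀ : ℝ, 0 < ε₀ ∧ ∀ C₀ : ℝ, 0 < C₀ → ∃ c₁ : ℝ, 1 < c₁ ∧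
      ∀ (c : ℝ) (u : ℝ → ℝ³ → ℝ³) (p : ℝ → ℝ³ → ℝ), 1 < c →
        IsClassicalNSSolutionOn (Iio 0) 1 0 u p → IsDiscretelySelfSimilar c u →
        HasTypeIDecay C₀ u → (C₀ ≤ ε₀ ∨ c < c₁) → ∀ t < 0, ∀ x, u t x = 0 := by
  obtain ⟨ε₀, hε₀, Hε⟩ := ancient_typeI_smallConstant_eq_zero
  refine ⟨ε₀, hε₀, fun C₀ hC₀ => ?_⟩
  obtain ⟨c₁, hc₁, H⟩ := h.1 C₀ hC₀
  refine ⟨c₁, hc₁, fun c u p h1 hsol hdss hI hor => ?_⟩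
  rcases hor with hsmall | hfine
  · exact Hε hC₀.le hsmall hsol hI
  · exact H c h1 hfine u p hsol hdss hI

end Conjuncts

end Literature.Barriers.NavierStokesRegularity

end
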